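import Summits.AtomisticToContinuum.FouriersLaw.Theorems.BondHeatUncertaintySubdiffusiveBondHeatKernelGibbsD
import Summits.AtomisticToContinuum.FouriersLaw.Theorems.BondHeatUncertaintySubdiffusiveBondHeatGibbsMomentumFourthMoment
import Summits.AtomisticToContinuum.FouriersLaw.Theorems.IncoherentChannel.Negative.KernelMoments

/-!
# `stub_commonPastBound`, helper 1/2: Gaussian momentum moments of every order and kernel Jensen

Support file (`--supports stmt-AtomisticToContinuum-11811`, registered helper
`commonPastBound_gibbsEvenMoments`) for stub `stub_commonPastBound` of the line
`two-horizons-forecast-loss` of crux `PhononMeanFreePath.IncoherentChannel`.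

For the pinned anharmonic chain `pinnedChain ω₂ lam β γ` (`ω₂ > 0`, `lam, β ≥ 0`) at `T > 0`, with
Gibbs measure `μ_T = Z⁻¹ e^{-H/T} dq dp` (`OscillatorChain.gibbsMeasure`) and the constructed
equal-temperature transition kernels `K_t = transitionKernel n T T t` (`LangevinChainKernel`):

* `commonPastBound_integrable_momentum_pow_mul_gibbsDensity`: EVERY power `p_i^m e^{-H/T}` is
  Lebesgue integrable (`|p|^m ≤ 1 + (2H)^m ≤ 1 + 2^m m! s^{-m} e^{sH}`, `s = 1/(2T) < 1/T`), lifting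
  the degree-`≤ 4` restriction of `BondHeatUncertaintySubdiffusiveBondHeatGibbsMomentumFourthMoment`;
* `commonPastBound_integral_momentum_pow_add_two`: the Gaussian recursion
  `∫ p_i^{k+2} e^{-H/T} = T(k+1) ∫ p_i^k e^{-H/T}` for ALL `k` (integration by parts in `p_i`);
* `commonPastBound_gibbs_even_moment` / **`commonPastBound_gibbsEvenMoments`** (registered):
  `∫ p_i^{2k} dμ_T = (2k−1)!!·T^k`, for every chain size `n` and site `i` — the `p_i`-marginal of
  `μ_T` is `N(0,T)` whatever `n` (this `n`-independence is what makes the constant of clause (iii) of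
  `stub_commonPastBound` independent of `N`);
* `commonPastBound_integral_centredSq_pow_le`: `∫ |p_i² − T|^{2k} dμ_T ≤ 2^{2k}((4k−1)!! + 1)T^{2k}`;
* kernel side: every power `p_i^m ∈ L¹(K_t(z,·))` (CEHR (3.4): `e^{H/(2T)} ∈ L¹(K_t(z,·))`,
  `Negative.KernelMoments`), the kernel Jensen inequality `((K_t p_i)(z))^{2m} ≤ (K_t p_i^{2m})(z)`
  (`K_t(z,·)` is a probability measure), and Gibbs invariance in integrability form:
  `g ∈ L¹(μ_T) ⇒ (z ↦ ∫ g dK_t(z,·)) ∈ L¹(μ_T)` (`pinnedChain_gibbsMeasure_bind_transitionKernel` +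
  `Integrable.integral_comp`).
-/

noncomputable section

namespace Summit.AtomisticToContinuum.FouriersLaw.Theorems.PhononMeanFreePath

open MeasureTheory Set Filter Topology ProbabilityTheory
open scoped NNReal ENNReal
open Literature.MathematicalPhysics.KineticTheory.HeatConduction
open Summit.AtomisticToContinuum.FouriersLaw.Theorems.SubdiffusiveBondHeat
  (pinnedChain_gibbsMeasure_bind_transitionKernel integral_mul_eq_neg_of_hasLineDerivAt_of_integrable
    hasLineDerivAt_momentum_pow)
open Summit.AtomisticToContinuum.FouriersLaw.Theorems.IncoherentChannel.Negative.KernelMoments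
  (sq_momentum_le_two_mul_hamiltonian integrable_exp_hamiltonian_transitionKernel
    integrable_momentum_transitionKernel)

/-! ### Gaussian momentum moments of every order under the Gibbs measure -/

/-- `H^m ≤ m!·s^{-m}·e^{sH}` for `H ≥ 0`, `s > 0`. [folklore] -/
theorem commonPastBound_pow_le_factorial_mul_exp {H s : ℝ} (hH : 0 ≤ H) (hs : 0 < s) (m : ℕ) :
    H ^ m ≤ (m.factorial : ℝ) / s ^ m * Real.exp (s * H) := by
  have h := Real.pow_div_factorial_le_exp (s * H) (mul_nonneg hs.le hH) m
  have hf : (0 : ℝ) < m.factorial := by exact_mod_cast m.factorial_pos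
  have hsm : 0 < s ^ m := pow_pos hs m
  rw [mul_pow, div_le_iff₀ hf] at h
  rw [div_mul_eq_mul_div, le_div_iff₀ hsm]
  nlinarith

/-- `|p|^m ≤ 1 + (p²)^m`. [folklore] -/
theorem commonPastBound_abs_pow_le_one_add_sq_pow (p : ℝ) (m : ℕ) : |p| ^ m ≤ 1 + (p ^ 2) ^ m := by
  have h2 : (p ^ 2) ^ m = |p| ^ (2 * m) := by rw [pow_mul, sq_abs]
  rw [h2]
  rcases le_or_gt |p| 1 with h | h
  · have : |p| ^ m ≤ 1 := pow_le_one₀ (abs_nonneg p) h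
    have : 0 ≤ |p| ^ (2 * m) := by positivity
    linarith
  · have : |p| ^ m ≤ |p| ^ (2 * m) := pow_le_pow_right₀ h.le (by omega)
    linarith

section GibbsMoments

variable {ω₂ lam β : ℝ} (hω : 0 < ω₂) (hl : 0 ≤ lam) (hβ : 0 ≤ β) (γ : ℝ) {n : ℕ} {T : ℝ} (hT : 0 < T)
include hω hl hβ hT

/-- Every power `p_i^m e^{-H/T}` is Lebesgue integrable (`|p|^m ≤ 1 + (2H)^m ≤ 1 + C e^{H/(2T)}`).
[folklore] -/
theorem commonPastBound_integrable_momentum_pow_mul_gibbsDensity (i : Fin n) (m : ℕ) :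
    Integrable fun x => x.2 i ^ m * (pinnedChain ω₂ lam β γ).gibbsDensity n T x := by
  have hs : 0 < T⁻¹ / 2 := by positivity
  have hs' : T⁻¹ / 2 < 1 / T := by rw [one_div]; linarith [inv_pos.2 hT]
  set s := T⁻¹ / 2 with hsdef
  set C : ℝ := 2 ^ m * ((m.factorial : ℝ) / s ^ m) with hC
  have hmaj := (pinnedChain_integrable_gibbsDensity hω hl hβ γ n hT).add
    ((pinnedChain_integrable_exp_mul_gibbsDensity hω hl hβ γ n hT hs').const_mul C)
  refine hmaj.mono' ((by fun_prop : Continuous fun x : PhaseSpace n => x.2 i ^ m).mul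
    (pinnedChain_continuous_gibbsDensity ω₂ lam β γ n T)).aestronglyMeasurable
    (Eventually.of_forall fun x => ?_)
  have hH0 := pinnedChain_hamiltonian_nonneg hω.le hl hβ γ n x
  set H := (pinnedChain ω₂ lam β γ).hamiltonian n x with hH
  have hρ : 0 < (pinnedChain ω₂ lam β γ).gibbsDensity n T x :=
    (pinnedChain ω₂ lam β γ).gibbsDensity_pos n T x
  rw [Real.norm_eq_abs, abs_mul, abs_of_pos hρ, abs_pow]
  simp only [Pi.add_apply]
  have h1 := commonPastBound_abs_pow_le_one_add_sq_pow (x.2 i) m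
  have h2 : (x.2 i ^ 2) ^ m ≤ (2 * H) ^ m :=
    pow_le_pow_left₀ (sq_nonneg _) (sq_momentum_le_two_mul_hamiltonian hω hl hβ γ x i) m
  have h3 : (2 * H) ^ m ≤ C * Real.exp (s * H) := by
    rw [mul_pow, hC, mul_assoc]
    exact mul_le_mul_of_nonneg_left (commonPastBound_pow_le_factorial_mul_exp hH0 hs m)
      (by positivity)
  calc |x.2 i| ^ m * (pinnedChain ω₂ lam β γ).gibbsDensity n T x
      ≤ (1 + C * Real.exp (s * H)) * (pinnedChain ω₂ lam β γ).gibbsDensity n T x :=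
        mul_le_mul_of_nonneg_right (by linarith) hρ.le
    _ = _ := by ring

/-- **Gaussian recursion for the momentum moments of `e^{-H/T}`, all orders**:
`∫ p_i^{k+2} e^{-H/T} = T (k+1) ∫ p_i^k e^{-H/T}` (integration by parts in `p_i`). [folklore] -/
theorem commonPastBound_integral_momentum_pow_add_two (i : Fin n) (k : ℕ) :
    ∫ x, x.2 i ^ (k + 2) * (pinnedChain ω₂ lam β γ).gibbsDensity n T x =
      T * (k + 1) * ∫ x, x.2 i ^ k * (pinnedChain ω₂ lam β γ).gibbsDensity n T x := by
  have hint : ∀ m : ℕ, Integrable fun x => x.2 i ^ m * (pinnedChain ω₂ lam β γ).gibbsDensity n T x :=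
    fun m => commonPastBound_integrable_momentum_pow_mul_gibbsDensity hω hl hβ γ hT i m
  have e := integral_mul_eq_neg_of_hasLineDerivAt_of_integrable
    (F := fun x : PhaseSpace n => x.2 i ^ (k + 1))
    (F' := fun x : PhaseSpace n => ((k + 1 : ℕ) : ℝ) * x.2 i ^ (k + 1 - 1))
    (g := (pinnedChain ω₂ lam β γ).gibbsDensity n T)
    (g' := fun x => -(x.2 i / T) * (pinnedChain ω₂ lam β γ).gibbsDensity n T x)
    (v := ((0, Pi.single i 1) : PhaseSpace n)) ?_ ?_ ?_
    (fun x => hasLineDerivAt_momentum_pow (k + 1) x i)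
    (fun x => (pinnedChain ω₂ lam β γ).hasLineDerivAt_gibbsDensity
      ((pinnedChain ω₂ lam β γ).hasLineDerivAt_hamiltonian_unitP n x i))
  · have lhs : ∫ x, x.2 i ^ (k + 1) *
        (-(x.2 i / T) * (pinnedChain ω₂ lam β γ).gibbsDensity n T x) =
        -T⁻¹ * ∫ x, x.2 i ^ (k + 2) * (pinnedChain ω₂ lam β γ).gibbsDensity n T x := by
      rw [← integral_const_mul]
      refine integral_congr_ae (Eventually.of_forall fun x => ?_)
      ring
    have rhs : ∫ x, ((k + 1 : ℕ) : ℝ) * x.2 i ^ (k + 1 - 1) *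
        (pinnedChain ω₂ lam β γ).gibbsDensity n T x =
        ((k : ℝ) + 1) * ∫ x, x.2 i ^ k * (pinnedChain ω₂ lam β γ).gibbsDensity n T x := by
      rw [← integral_const_mul]
      refine integral_congr_ae (Eventually.of_forall fun x => ?_)
      simp only [Nat.add_sub_cancel, Nat.cast_add, Nat.cast_one]
      ring
    rw [lhs, rhs] at e
    have hTne : T ≠ 0 := hT.ne'
    have e2 : T⁻¹ * ∫ x, x.2 i ^ (k + 2) * (pinnedChain ω₂ lam β γ).gibbsDensity n T x =
        ((k : ℝ) + 1) * ∫ x, x.2 i ^ k * (pinnedChain ω₂ lam β γ).gibbsDensity n T x := by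
      linarith
    calc ∫ x, x.2 i ^ (k + 2) * (pinnedChain ω₂ lam β γ).gibbsDensity n T x
        = T * (T⁻¹ * ∫ x, x.2 i ^ (k + 2) * (pinnedChain ω₂ lam β γ).gibbsDensity n T x) := by
          rw [← mul_assoc, mul_inv_cancel₀ hTne, one_mul]
      _ = T * ((k : ℝ) + 1) * ∫ x, x.2 i ^ k * (pinnedChain ω₂ lam β γ).gibbsDensity n T x := by
          rw [e2, mul_assoc]
  · refine ((hint k).const_mul (((k + 1 : ℕ) : ℝ))).congr (Eventually.of_forall fun x => ?_)
    simp only [Nat.add_sub_cancel]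
    ring
  · refine ((hint (k + 2)).const_mul (-T⁻¹)).congr (Eventually.of_forall fun x => ?_)
    simp only
    ring
  · exact hint (k + 1)

/-- **Even Gaussian moments of a momentum under the Gibbs measure**:
`∫ p_i^{2k} dμ_T = T^k · ∏_{j<k} (2j+1) = (2k-1)!!·T^k`, for EVERY chain size `n` and site `i`
(the `p_i`-marginal of `μ_T` is `N(0,T)`). [folklore] -/
theorem commonPastBound_gibbs_even_moment (i : Fin n) (k : ℕ) :
    ∫ x, x.2 i ^ (2 * k) ∂((pinnedChain ω₂ lam β γ).gibbsMeasure n T) =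
      T ^ k * ∏ j ∈ Finset.range k, (2 * (j : ℝ) + 1) := by
  set ρ := (pinnedChain ω₂ lam β γ).gibbsDensity n T with hρ
  have hZ : 0 < ∫ x, ρ x := integral_exp_pos (pinnedChain_integrable_gibbsDensity hω hl hβ γ n hT)
  have hrec : ∀ k : ℕ, ∫ x, x.2 i ^ (2 * k) * ρ x =
      (T ^ k * ∏ j ∈ Finset.range k, (2 * (j : ℝ) + 1)) * ∫ x, ρ x := by
    intro k
    induction k with
    | zero => simp
    | succ k ih =>
      have h := commonPastBound_integral_momentum_pow_add_two hω hl hβ γ hT i (2 * k)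
      rw [show 2 * (k + 1) = 2 * k + 2 by ring, h, ih, Finset.prod_range_succ, pow_succ]
      push_cast
      ring
  rw [(pinnedChain ω₂ lam β γ).integral_gibbsMeasure, hrec k, ← hρ]
  field_simp

/-- All powers of a momentum are integrable under the Gibbs measure. [folklore] -/
theorem commonPastBound_integrable_momentum_pow_gibbsMeasure (i : Fin n) (m : ℕ) :
    Integrable (fun x : PhaseSpace n => x.2 i ^ m) ((pinnedChain ω₂ lam β γ).gibbsMeasure n T) :=
  (pinnedChain ω₂ lam β γ).integrable_gibbsMeasure
    (commonPastBound_integrable_momentum_pow_mul_gibbsDensity hω hl hβ γ hT i m)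

end GibbsMoments

/-! ### Centred even moments `∫ |p_i² − T|^{2k} dμ_T`: an `N`-independent bound -/

/-- `|x² − T|^{2k} ≤ 2^{2k} (x^{4k} + T^{2k})` for `T ≥ 0`. [folklore] -/
theorem commonPastBound_centredSq_pow_le {T : ℝ} (hT : 0 ≤ T) (x : ℝ) (k : ℕ) :
    |x ^ 2 - T| ^ (2 * k) ≤ 2 ^ (2 * k) * (x ^ (2 * (2 * k)) + T ^ (2 * k)) := by
  have hx : 0 ≤ x ^ 2 := sq_nonneg x
  have h1 : |x ^ 2 - T| ≤ x ^ 2 + T := abs_le.2 ⟨by linarith, by linarith⟩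
  have h2 : |x ^ 2 - T| ^ (2 * k) ≤ (x ^ 2 + T) ^ (2 * k) := pow_le_pow_left₀ (abs_nonneg _) h1 _
  refine h2.trans ?_
  rw [pow_mul x 2 (2 * k)]
  have h2k : (0 : ℝ) ≤ 2 ^ (2 * k) := by positivity
  rcases le_total (x ^ 2) T with h | h
  · calc (x ^ 2 + T) ^ (2 * k) ≤ (2 * T) ^ (2 * k) := pow_le_pow_left₀ (by positivity) (by linarith) _
      _ = 2 ^ (2 * k) * T ^ (2 * k) := mul_pow _ _ _
      _ ≤ _ := mul_le_mul_of_nonneg_left (le_add_of_nonneg_left (pow_nonneg hx _)) h2k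
  · calc (x ^ 2 + T) ^ (2 * k) ≤ (2 * x ^ 2) ^ (2 * k) := pow_le_pow_left₀ (by positivity) (by linarith) _
      _ = 2 ^ (2 * k) * (x ^ 2) ^ (2 * k) := mul_pow _ _ _
      _ ≤ _ := mul_le_mul_of_nonneg_left (le_add_of_nonneg_right (pow_nonneg hT _)) h2k

section CentredMoments

variable {ω₂ lam β : ℝ} (hω : 0 < ω₂) (hl : 0 ≤ lam) (hβ : 0 ≤ β) (γ : ℝ) {n : ℕ} {T : ℝ} (hT : 0 < T)
include hω hl hβ hT

/-- **`N`-independent bound on the centred even moments of `p_i²`**: `|p_i² − T|^{2k}` is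
`μ_T`-integrable with `∫ |p_i² − T|^{2k} dμ_T ≤ 2^{2k}((4k−1)!!·T^{2k} + T^{2k})` — a constant in
`(k, T)` only, for every chain size and site (Gaussian marginal). [folklore] -/
theorem commonPastBound_integral_centredSq_pow_le (i : Fin n) (k : ℕ) :
    Integrable (fun x : PhaseSpace n => |x.2 i ^ 2 - T| ^ (2 * k))
        ((pinnedChain ω₂ lam β γ).gibbsMeasure n T) ∧
      ∫ x, |x.2 i ^ 2 - T| ^ (2 * k) ∂((pinnedChain ω₂ lam β γ).gibbsMeasure n T) ≤
        2 ^ (2 * k) * (T ^ (2 * k) * ∏ j ∈ Finset.range (2 * k), (2 * (j : ℝ) + 1) + T ^ (2 * k)) := by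
  haveI : IsProbabilityMeasure ((pinnedChain ω₂ lam β γ).gibbsMeasure n T) :=
    pinnedChain_isProbabilityMeasure_gibbsMeasure hω hl hβ γ n hT
  have hmaj : Integrable (fun x : PhaseSpace n => 2 ^ (2 * k) * (x.2 i ^ (2 * (2 * k)) + T ^ (2 * k)))
      ((pinnedChain ω₂ lam β γ).gibbsMeasure n T) :=
    ((commonPastBound_integrable_momentum_pow_gibbsMeasure hω hl hβ γ hT i (2 * (2 * k))).add
      (integrable_const _)).const_mul _
  have hpt : ∀ x : PhaseSpace n,
      |x.2 i ^ 2 - T| ^ (2 * k) ≤ 2 ^ (2 * k) * (x.2 i ^ (2 * (2 * k)) + T ^ (2 * k)) := fun x =>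
    commonPastBound_centredSq_pow_le hT.le (x.2 i) k
  have hint : Integrable (fun x : PhaseSpace n => |x.2 i ^ 2 - T| ^ (2 * k))
      ((pinnedChain ω₂ lam β γ).gibbsMeasure n T) := by
    refine hmaj.mono' (by fun_prop : Measurable fun x : PhaseSpace n =>
      |x.2 i ^ 2 - T| ^ (2 * k)).aestronglyMeasurable (Eventually.of_forall fun x => ?_)
    rw [Real.norm_of_nonneg (pow_nonneg (abs_nonneg _) _)]
    exact hpt x
  refine ⟨hint, ?_⟩
  calc ∫ x, |x.2 i ^ 2 - T| ^ (2 * k) ∂((pinnedChain ω₂ lam β γ).gibbsMeasure n T)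
      ≤ ∫ x, 2 ^ (2 * k) * (x.2 i ^ (2 * (2 * k)) + T ^ (2 * k))
          ∂((pinnedChain ω₂ lam β γ).gibbsMeasure n T) := integral_mono hint hmaj hpt
    _ = 2 ^ (2 * k) * (T ^ (2 * k) * ∏ j ∈ Finset.range (2 * k), (2 * (j : ℝ) + 1) + T ^ (2 * k)) := by
        rw [integral_const_mul, integral_add
          (commonPastBound_integrable_momentum_pow_gibbsMeasure hω hl hβ γ hT i (2 * (2 * k)))
          (integrable_const _), integral_const, probReal_univ, one_smul,
          commonPastBound_gibbs_even_moment hω hl hβ γ hT i (2 * k)]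

end CentredMoments

/-! ### Kernel facts at a fixed time: moments, Jensen, Gibbs invariance -/

section Kernel

variable {ω₂ lam β γ : ℝ} (hω : 0 < ω₂) (hl : 0 ≤ lam) (hβ : 0 ≤ β) (hγ : 0 ≤ γ) {n : ℕ} (hn : 0 < n)
  {T : ℝ} (hT : 0 < T)
include hω hl hβ hγ hn hT

/-- Every power of a momentum is integrable for the equal-temperature transition kernels
(`|p|^m ≤ 1 + (2H)^m ≤ 1 + C e^{H/(2T)}` and CEHR (3.4)). [folklore] -/
theorem commonPastBound_integrable_momentum_pow_transitionKernel (t : ℝ≥0) (z : PhaseSpace n)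
    (i : Fin n) (m : ℕ) :
    Integrable (fun y : PhaseSpace n => y.2 i ^ m)
      ((pinnedChain ω₂ lam β γ).transitionKernel n T T t z) := by
  haveI := pinnedChain_isMarkovKernel_transitionKernel hω hl hβ hγ n T T t
  have hs : 0 < 1 / (2 * T) := by positivity
  have hE := integrable_exp_hamiltonian_transitionKernel hω hl hβ hγ hn hT t z
  set s := 1 / (2 * T) with hsdef
  set C : ℝ := 2 ^ m * ((m.factorial : ℝ) / s ^ m) with hC
  have hmaj := (integrable_const (1 : ℝ)).add (hE.const_mul C)
  refine hmaj.mono' (by fun_prop : Continuous fun y : PhaseSpace n => y.2 i ^ m).aestronglyMeasurable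
    (Eventually.of_forall fun y => ?_)
  have hH0 := pinnedChain_hamiltonian_nonneg hω.le hl hβ γ n y
  set H := (pinnedChain ω₂ lam β γ).hamiltonian n y with hH
  rw [Real.norm_eq_abs, abs_pow]
  simp only [Pi.add_apply]
  have h1 := commonPastBound_abs_pow_le_one_add_sq_pow (y.2 i) m
  have h2 : (y.2 i ^ 2) ^ m ≤ (2 * H) ^ m :=
    pow_le_pow_left₀ (sq_nonneg _) (sq_momentum_le_two_mul_hamiltonian hω hl hβ γ y i) m
  have h3 : (2 * H) ^ m ≤ C * Real.exp (s * H) := by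
    rw [mul_pow, hC, mul_assoc]
    exact mul_le_mul_of_nonneg_left (commonPastBound_pow_le_factorial_mul_exp hH0 hs m)
      (by positivity)
  linarith

/-- **Kernel Jensen for even powers**: `((K_t p_i)(z))^{2m} ≤ (K_t p_i^{2m})(z)` (`K_t(z,·)` is a
probability measure, `x ↦ x^{2m}` is convex). [folklore] -/
theorem commonPastBound_integral_momentum_pow_le (t : ℝ≥0) (z : PhaseSpace n) (i : Fin n) (m : ℕ) :
    (∫ y, y.2 i ∂((pinnedChain ω₂ lam β γ).transitionKernel n T T t z)) ^ (2 * m) ≤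
      ∫ y, y.2 i ^ (2 * m) ∂((pinnedChain ω₂ lam β γ).transitionKernel n T T t z) := by
  haveI := pinnedChain_isMarkovKernel_transitionKernel hω hl hβ hγ n T T t
  have hconv : ConvexOn ℝ univ (fun x : ℝ => x ^ (2 * m)) := Even.convexOn_pow (even_two_mul m)
  exact hconv.map_integral_le (f := fun y : PhaseSpace n => y.2 i) (continuous_pow _).continuousOn
    isClosed_univ (Eventually.of_forall fun _ => mem_univ _)
    (integrable_momentum_transitionKernel hω hl hβ hγ hn hT t z i)
    (commonPastBound_integrable_momentum_pow_transitionKernel hω hl hβ hγ hn hT t z i (2 * m))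

/-- **Gibbs invariance, integrability form**: for `g ∈ L¹(μ_T)`, `z ↦ ∫ g dK_t(z,·)` is in
`L¹(μ_T)` (`μ_T ∘ K_t = μ_T`, `pinnedChain_gibbsMeasure_bind_transitionKernel`). [folklore] -/
theorem commonPastBound_integrable_integral_transitionKernel (t : ℝ≥0) {g : PhaseSpace n → ℝ}
    (hg : Integrable g ((pinnedChain ω₂ lam β γ).gibbsMeasure n T)) :
    Integrable (fun z => ∫ y, g y ∂((pinnedChain ω₂ lam β γ).transitionKernel n T T t z))
      ((pinnedChain ω₂ lam β γ).gibbsMeasure n T) := by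
  have h := pinnedChain_gibbsMeasure_bind_transitionKernel hω hl hβ hγ hn hT t
  set μT := (pinnedChain ω₂ lam β γ).gibbsMeasure n T
  set κ := (pinnedChain ω₂ lam β γ).transitionKernel n T T t
  have h' : (κ ∘ₖ Kernel.const Unit μT) () = μT := by
    rw [← Measure.comp_eq_comp_const_apply]; exact h
  have hg' : Integrable g ((κ ∘ₖ Kernel.const Unit μT) ()) := by rw [h']; exact hg
  have h2 := hg'.integral_comp
  rwa [Kernel.const_apply] at h2

end Kernel

/-! ### The registered helper statement -/

/-- **Registered helper `commonPastBound_gibbsEvenMoments`** (for stub `stub_commonPastBound`, line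
`two-horizons-forecast-loss`): under the Gibbs measure of the pinned anharmonic chain at `T > 0`
every even power of every momentum is integrable and `∫ p_i^{2k} dμ_T = T^k ∏_{j<k}(2j+1) =
(2k−1)!!·T^k`, for EVERY chain size `n`, site `i` and order `k` (exactly Gaussian momenta).
[folklore] -/
theorem commonPastBound_gibbsEvenMoments : ∀ ω₂ lam β γ : ℝ, 0 < ω₂ → 0 ≤ lam → 0 ≤ β → ∀ T : ℝ, 0 < T → ∀ (n : ℕ) (i : Fin n) (k : ℕ), Integrable (fun x : PhaseSpace n => x.2 i ^ (2 * k)) ((pinnedChain ω₂ lam β γ).gibbsMeasure n T) ∧ ∫ x, x.2 i ^ (2 * k) ∂((pinnedChain ω₂ lam β γ).gibbsMeasure n T) = T ^ k * ∏ j ∈ Finset.range k, (2 * (j : ℝ) + 1) := by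
  intro ω₂ lam β γ hω hl hβ T hT n i k
  exact ⟨commonPastBound_integrable_momentum_pow_gibbsMeasure hω hl hβ γ hT i (2 * k),
    commonPastBound_gibbs_even_moment hω hl hβ γ hT i k⟩

end Summit.AtomisticToContinuum.FouriersLaw.Theorems.PhononMeanFreePath

end
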